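import Literature.IUT.LogVolume.NormalizedHaar
import Mathlib.Topology.Algebra.Nonarchimedean.Basic
import Mathlib.GroupTheory.QuotientGroup.Defs
import HarnessLib

/-!
# [AbsTopIII] Prop. 5.7 (i)(a) as printed: uniqueness of the finitely additive volume; coset decompositions

[AbsTopIII] Prop. 5.7 (i)(a) (kurims p. 137) asserts existence and UNIQUENESS of a map
`μ_k : M(k) → ℝ_{>0}` on the compact open subsets `M(k)` of a nonarchimedean local field `k` with
"(1) additivity, i.e., `μ_k(A ∪ B) = μ_k(A) + μ_k(B)`, for `A, B ∈ M(k)` such that `A ∩ B = ∅`;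
(2) ⊞-translation invariance, i.e., `μ_k(A + x) = μ_k(A)`, for `A ∈ M(k)`, `x ∈ k`; (3) normalization,
i.e., `μ_k(O_k) = 1`" — a statement about FINITELY additive set functions, stronger than uniqueness of
Haar measure. Its proof ("follows immediately from well-known properties of the Haar measure") and the
proof of the log-compatibility (c) (p. 139: "it suffices [by the additivity property of `μ_k(−)`] to
verify part (c) for `A` of the form `x + m_k^n` for `n` a sufficiently large positive integer … `log_k`
determines a bijection `x + m_k^n ≅ log_k(x) + m_k^n`, so the equality … follows from the ⊞-translation
invariance") both rest on ONE structural fact: every compact open subset is a finite disjoint union of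
cosets of a small open subgroup. This file proves that fact and both consequences for an arbitrary
NONARCHIMEDEAN abelian group `V` (Mathlib `NonarchimedeanAddGroup`: every neighbourhood of `0` contains
an open subgroup — ultrametric normed groups, `ℚ_p`, `K_v`, their finite products) with an integral
structure `Λ` (`NormalizedHaar.lean`):

* `exists_openAddSubgroup_cosets_subset` / `exists_finset_eq_biUnion_coset`: for `A ∈ M(V)` there is an
  open subgroup `H ≤ Λ` and finitely many PAIRWISE DISJOINT cosets `a_i + H`, `a_i ∈ A`, with
  `A = ⋃ (a_i + H)`; hence `μ_Λ(A) = n · μ_Λ(H)` (`haar_eq_card_mul`);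
* `IsFinAddVolume Λ f` = the printed (1)(2)(3) for `f : CompactOpens V → ℝ`; `isFinAddVolume_haar`
  (existence: `A ↦ μ_Λ(A)`), `IsFinAddVolume.eq_haar` (UNIQUENESS: any such `f` is `μ_Λ`), packaged as
  `existsUnique_isFinAddVolume`;
* `haar_image_eq_of_coset_translate` — the measure-theoretic content of (c): a map `g`, injective on
  `A`, that carries each small coset `a + H ⊆ A` onto the coset `g(a) + H`, preserves volume:
  `μ_Λ(g(A)) = μ_Λ(A)` (instantiated to `g = log_k` by the `p`-adic-logarithm files of this campaign).
[cite: MochizukiAbsTopIII2015, Prop. 5.7 (i)(a)(c) pp. 137–139]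
Deliberately NOT here: the `p`-adic logarithm itself, local fields (see `LocalFieldVolume.lean`).
-/

noncomputable section

open MeasureTheory MeasureTheory.Measure Set TopologicalSpace Filter
open scoped ENNReal NNReal Pointwise Topology

namespace Literature.IUT.LogVolume

namespace IntegralStructure

section Cosets

variable {V : Type*} [AddCommGroup V] [TopologicalSpace V] [IsTopologicalAddGroup V]
  (Λ : IntegralStructure V)

/-! ### Cosets of open subgroups inside compact open sets -/

omit [TopologicalSpace V] [IsTopologicalAddGroup V] in
/-- The fibre of `V → V/H` over the class of `a` is the coset `a + H`. [folklore] -/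
private theorem preimage_mk_singleton' (H : AddSubgroup V) (a : V) :
    (QuotientAddGroup.mk (s := H)) ⁻¹' {(a : V ⧸ H)} = a +ᵥ (H : Set V) := by
  ext x
  simp only [mem_preimage, mem_singleton_iff, mem_leftAddCoset_iff]
  rw [eq_comm, QuotientAddGroup.eq]
  rfl

omit [IsTopologicalAddGroup V] in
/-- The fibre of `V → V/H` over the class of `a` is the coset `a + H` (`H` open). [folklore] -/
private theorem preimage_mk_singleton (H : OpenAddSubgroup V) (a : V) :
    (QuotientAddGroup.mk (s := (H : AddSubgroup V))) ⁻¹' {(a : V ⧸ (H : AddSubgroup V))} =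
      a +ᵥ (H : Set V) :=
  preimage_mk_singleton' (H : AddSubgroup V) a

omit [IsTopologicalAddGroup V] in
/-- Distinct classes have disjoint cosets. [folklore] -/
private theorem disjoint_coset_of_ne (H : OpenAddSubgroup V) {a b : V}
    (h : (a : V ⧸ (H : AddSubgroup V)) ≠ (b : V ⧸ (H : AddSubgroup V))) :
    Disjoint (a +ᵥ (H : Set V)) (b +ᵥ (H : Set V)) := by
  rw [← preimage_mk_singleton, ← preimage_mk_singleton]
  exact Disjoint.preimage _ (disjoint_singleton.mpr h)

/-- **Coset decomposition**: if every point `a` of the compact open `A` satisfies `a + H ⊆ A`, then `A`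
is the union of finitely many cosets `a_c + H` (`a_c ∈ A`) indexed by distinct classes `c ∈ V/H` — in
particular pairwise disjoint. [cite: MochizukiAbsTopIII2015, Prop. 5.7 (i)(c) proof p. 139] -/
theorem exists_finset_eq_biUnion_coset (A : CompactOpens V) (H : OpenAddSubgroup V)
    (hHA : ∀ a ∈ (A : Set V), a +ᵥ (H : Set V) ⊆ A) :
    ∃ (C : Finset (V ⧸ (H : AddSubgroup V))) (rep : V ⧸ (H : AddSubgroup V) → V),
      (∀ c ∈ C, rep c ∈ (A : Set V) ∧ (rep c : V ⧸ (H : AddSubgroup V)) = c) ∧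
      (A : Set V) = ⋃ c ∈ C, rep c +ᵥ (H : Set V) := by
  classical
  obtain ⟨t, htA, hcover⟩ := A.isCompact.elim_nhds_subcover (fun a => a +ᵥ (H : Set V))
    (fun a _ => (H.isOpen.vadd a).mem_nhds (Set.mem_vadd_set.mpr ⟨0, H.zero_mem, by simp⟩))
  let π : V → V ⧸ (H : AddSubgroup V) := QuotientAddGroup.mk
  let C : Finset (V ⧸ (H : AddSubgroup V)) := t.image π
  have hrep : ∀ c : V ⧸ (H : AddSubgroup V), ∃ a : V, c ∈ C → a ∈ t ∧ π a = c := by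
    intro c
    by_cases hc : c ∈ C
    · obtain ⟨a, ha, rfl⟩ := Finset.mem_image.mp hc
      exact ⟨a, fun _ => ⟨ha, rfl⟩⟩
    · exact ⟨0, fun h => absurd h hc⟩
  choose rep hrep using hrep
  refine ⟨C, rep, fun c hc => ⟨htA _ (hrep c hc).1, (hrep c hc).2⟩, ?_⟩
  apply le_antisymm
  · intro x hx
    obtain ⟨a, ha, hxa⟩ : ∃ a ∈ t, x ∈ a +ᵥ (H : Set V) := by
      simpa only [mem_iUnion, exists_prop] using hcover hx
    have hc : π a ∈ C := Finset.mem_image.mpr ⟨a, ha, rfl⟩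
    refine mem_iUnion₂.mpr ⟨π a, hc, ?_⟩
    have h1 : x ∈ π ⁻¹' {π a} := by rw [preimage_mk_singleton]; exact hxa
    have h2 : π ⁻¹' {π (rep (π a))} = rep (π a) +ᵥ (H : Set V) := preimage_mk_singleton H _
    rw [← h2, (hrep _ hc).2]
    exact h1
  · intro x hx
    obtain ⟨c, hc, hxc⟩ := mem_iUnion₂.mp hx
    exact hHA _ (htA _ (hrep c hc).1) hxc

/-- **Counting cosets**: `μ_Λ(⋃_{c ∈ C} (a_c + H)) = |C| · μ_Λ(H)` for distinct classes `c`.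
[cite: MochizukiAbsTopIII2015, Prop. 5.7 (i)(a) p. 137] -/
theorem haar_biUnion_coset [MeasurableSpace V] [BorelSpace V] (H : OpenAddSubgroup V)
    (C : Finset (V ⧸ (H : AddSubgroup V))) (rep : V ⧸ (H : AddSubgroup V) → V)
    (hrep : ∀ c ∈ C, (rep c : V ⧸ (H : AddSubgroup V)) = c) :
    Λ.haar (⋃ c ∈ C, rep c +ᵥ (H : Set V)) = C.card * Λ.haar (H : Set V) := by
  rw [measure_biUnion_finset]
  · simp only [haar_vadd, Finset.sum_const, nsmul_eq_mul]
  · intro c hc c' hc' hne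
    have : (rep c : V ⧸ (H : AddSubgroup V)) ≠ (rep c' : V ⧸ (H : AddSubgroup V)) := by
      rwa [hrep c hc, hrep c' hc']
    exact disjoint_coset_of_ne H this
  · exact fun c _ => (H.isOpen.vadd (rep c)).measurableSet

/-! ### Finitely additive, translation-invariant, normalised functions on `M(V)` -/

/-- `Λ` as an element of `M(V)` (a compact open set). [cite: MochizukiAbsTopIII2015, Prop. 5.7 (i)(a) p. 137] -/
def toCompactOpens : CompactOpens V := ⟨⟨(Λ : Set V), Λ.isCompact⟩, Λ.isOpen⟩

omit [IsTopologicalAddGroup V] in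
/-- `Λ.toCompactOpens` as a set. [cite: MochizukiAbsTopIII2015, Prop. 5.7 (i)(a) p. 137] -/
@[simp] theorem coe_toCompactOpens : (Λ.toCompactOpens : Set V) = (Λ : Set V) := rfl

/-- The translate `x + A` of a compact open set (again compact open).
[cite: MochizukiAbsTopIII2015, Prop. 5.7 (i)(a)(2) p. 137] -/
def translate (x : V) (A : CompactOpens V) : CompactOpens V :=
  A.map (fun y => x + y) (continuous_const_add x) (isOpenMap_add_left x)

/-- `translate x A` as a set is `x + A`. [cite: MochizukiAbsTopIII2015, Prop. 5.7 (i)(a)(2) p. 137] -/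
@[simp] theorem coe_translate (x : V) (A : CompactOpens V) :
    (translate x A : Set V) = x +ᵥ (A : Set V) := by
  rw [translate, CompactOpens.coe_map, ← Set.image_vadd]
  rfl

/-- An open subgroup `H ≤ Λ` as a compact open set (closed in the compact `Λ`).
[cite: MochizukiAbsTopIII2015, Prop. 5.7 (i)(a) p. 137] -/
def subgroupCompactOpens (H : OpenAddSubgroup V)
    (hH : (H : AddSubgroup V) ≤ (Λ.toOpenAddSubgroup : AddSubgroup V)) : CompactOpens V :=
  ⟨⟨(H : Set V), Λ.isCompact.of_isClosed_subset H.isClosed (fun _ hx => hH hx)⟩, H.isOpen⟩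

/-- `subgroupCompactOpens` as a set. [cite: MochizukiAbsTopIII2015, Prop. 5.7 (i)(a) p. 137] -/
@[simp] theorem coe_subgroupCompactOpens (H : OpenAddSubgroup V)
    (hH : (H : AddSubgroup V) ≤ (Λ.toOpenAddSubgroup : AddSubgroup V)) :
    (Λ.subgroupCompactOpens H hH : Set V) = (H : Set V) := rfl

/-- **The printed conditions (1)(2)(3)** on a map `μ : M(V) → ℝ`: "(1) additivity, i.e., `μ_k(A ∪ B) =
μ_k(A) + μ_k(B)`, for `A, B ∈ M(k)` such that `A ∩ B = ∅`; (2) ⊞-translation invariance, i.e.,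
`μ_k(A + x) = μ_k(A)` …; (3) normalization, i.e., `μ_k(O_k) = 1`" (with `O_k` replaced by `Λ`).
[cite: MochizukiAbsTopIII2015, Prop. 5.7 (i)(a) p. 137] -/
structure IsFinAddVolume (f : CompactOpens V → ℝ) : Prop where
  /-- (1) additivity on disjoint compact open sets -/
  add : ∀ A B : CompactOpens V, Disjoint (A : Set V) (B : Set V) → f (A ⊔ B) = f A + f B
  /-- (2) translation invariance -/
  vadd : ∀ (x : V) (A : CompactOpens V), f (translate x A) = f A
  /-- (3) normalisation `f(Λ) = 1` -/
  normalized : f Λ.toCompactOpens = 1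

variable {Λ}

/-- A finitely additive `f` vanishes on `∅`. [cite: MochizukiAbsTopIII2015, Prop. 5.7 (i)(a) p. 137] -/
theorem IsFinAddVolume.map_bot {f : CompactOpens V → ℝ} (hf : IsFinAddVolume Λ f) : f ⊥ = 0 := by
  have := hf.add ⊥ ⊥ (by simp)
  simp only [le_refl, sup_of_le_left] at this
  linarith

/-- Finite additivity over a pairwise disjoint finite family.
[cite: MochizukiAbsTopIII2015, Prop. 5.7 (i)(a)(1) p. 137] -/
theorem IsFinAddVolume.map_finsetSup {f : CompactOpens V → ℝ} (hf : IsFinAddVolume Λ f) {ι : Type*}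
    (s : Finset ι) (P : ι → CompactOpens V)
    (hP : (s : Set ι).PairwiseDisjoint (fun i => (P i : Set V))) :
    f (s.sup P) = ∑ i ∈ s, f (P i) := by
  classical
  induction s using Finset.induction_on with
  | empty => simp [hf.map_bot]
  | insert i s hi ih =>
    rw [Finset.sup_insert, Finset.sum_insert hi, hf.add, ih (hP.subset (by simp))]
    rw [CompactOpens.coe_finsetSup, Set.disjoint_iUnion₂_right]
    intro j hj
    exact hP (Finset.mem_insert_self i s) (Finset.mem_insert_of_mem hj)
      (ne_of_mem_of_not_mem hj hi).symm

/-- A finitely additive translation-invariant `f` on a union of `|C|` distinct `H`-cosets takes the value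
`|C| · f(H)`. [cite: MochizukiAbsTopIII2015, Prop. 5.7 (i)(a) p. 137] -/
theorem IsFinAddVolume.map_eq_card_mul {f : CompactOpens V → ℝ} (hf : IsFinAddVolume Λ f)
    (H : OpenAddSubgroup V) (hH : (H : AddSubgroup V) ≤ (Λ.toOpenAddSubgroup : AddSubgroup V))
    (A : CompactOpens V) (C : Finset (V ⧸ (H : AddSubgroup V))) (rep : V ⧸ (H : AddSubgroup V) → V)
    (hrep : ∀ c ∈ C, (rep c : V ⧸ (H : AddSubgroup V)) = c)
    (hA : (A : Set V) = ⋃ c ∈ C, rep c +ᵥ (H : Set V)) :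
    f A = C.card * f (Λ.subgroupCompactOpens H hH) := by
  classical
  have hA' : A = C.sup (fun c => translate (rep c) (Λ.subgroupCompactOpens H hH)) := by
    apply CompactOpens.ext
    rw [CompactOpens.coe_finsetSup, hA]
    simp only [coe_translate, coe_subgroupCompactOpens]
  rw [hA', hf.map_finsetSup]
  · simp only [hf.vadd, Finset.sum_const, nsmul_eq_mul]
  · intro c hc c' hc' hne
    have : (rep c : V ⧸ (H : AddSubgroup V)) ≠ (rep c' : V ⧸ (H : AddSubgroup V)) := by
      rwa [hrep c hc, hrep c' hc']
    change Disjoint (translate (rep c) (Λ.subgroupCompactOpens H hH) : Set V)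
      (translate (rep c') (Λ.subgroupCompactOpens H hH) : Set V)
    rw [coe_translate, coe_translate, coe_subgroupCompactOpens]
    exact disjoint_coset_of_ne H this

variable (Λ) [MeasurableSpace V] [BorelSpace V]

/-- **Existence**: `A ↦ μ_Λ(A)` satisfies (1)(2)(3). [cite: MochizukiAbsTopIII2015, Prop. 5.7 (i)(a) p. 137] -/
theorem isFinAddVolume_haar : IsFinAddVolume Λ (fun A => (Λ.haar (A : Set V)).toReal) where
  add A B h := by
    simp only [CompactOpens.coe_sup]
    rw [measure_union h B.isOpen.measurableSet, ENNReal.toReal_add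
      (Λ.haar_compactOpens_lt_top A).ne (Λ.haar_compactOpens_lt_top B).ne]
  vadd x A := by rw [coe_translate, haar_vadd]
  normalized := by simp

/-! ### Log-compatibility, measure-theoretic core of [AbsTopIII] Prop. 5.7 (i)(c) -/

/-- **Volume preservation by coset translations**: let `A ∈ M(V)`, `H` an open subgroup with
`a + H ⊆ A` for all `a ∈ A`, and `g : V → V` injective on `A` with `g(a + H) = g(a) + H` for all `a ∈ A`
("`log_k` determines a bijection `x + m_k^n ≅ log_k(x) + m_k^n`"). Then `μ_Λ(g(A)) = μ_Λ(A)` ("so the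
equality `μ^log_k(A) = μ^log_k(log_k(A))` follows from the ⊞-translation invariance of `μ^log_k`").
[cite: MochizukiAbsTopIII2015, Prop. 5.7 (i)(c) pp. 138–139] -/
theorem haar_image_eq_of_coset_translate (A : CompactOpens V) (H : OpenAddSubgroup V)
    (hHA : ∀ a ∈ (A : Set V), a +ᵥ (H : Set V) ⊆ A) (g : V → V) (hinj : InjOn g A)
    (hg : ∀ a ∈ (A : Set V), g '' (a +ᵥ (H : Set V)) = g a +ᵥ (H : Set V)) :
    Λ.haar (g '' (A : Set V)) = Λ.haar A := by
  classical
  obtain ⟨C, rep, hrep, hAeq⟩ := exists_finset_eq_biUnion_coset A H hHA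
  have himg : g '' (A : Set V) = ⋃ c ∈ C, g (rep c) +ᵥ (H : Set V) := by
    rw [hAeq, image_iUnion₂]
    exact iUnion₂_congr fun c hc => hg _ (hrep c hc).1
  rw [himg, measure_biUnion_finset, hAeq, Λ.haar_biUnion_coset H C rep (fun c hc => (hrep c hc).2)]
  · simp only [haar_vadd, Finset.sum_const, nsmul_eq_mul]
  · -- the image cosets are pairwise disjoint, by injectivity of `g` on `A`
    intro c hc c' hc' hne
    refine Set.disjoint_left.mpr fun z hz hz' => hne ?_
    change z ∈ g (rep c) +ᵥ (H : Set V) at hz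
    change z ∈ g (rep c') +ᵥ (H : Set V) at hz'
    rw [← hg _ (hrep c hc).1] at hz
    rw [← hg _ (hrep c' hc').1] at hz'
    obtain ⟨x, hx, rfl⟩ := hz
    obtain ⟨x', hx', hxx'⟩ := hz'
    have hxA : x ∈ (A : Set V) := hHA _ (hrep c hc).1 hx
    have hx'A : x' ∈ (A : Set V) := hHA _ (hrep c' hc').1 hx'
    have hxeq : x' = x := hinj hx'A hxA hxx'
    subst hxeq
    rw [← preimage_mk_singleton, (hrep c hc).2] at hx
    rw [← preimage_mk_singleton, (hrep c' hc').2] at hx'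
    simp only [mem_preimage, mem_singleton_iff] at hx hx'
    rw [← hx, ← hx']
  · exact fun c _ => (H.isOpen.vadd (g (rep c))).measurableSet

/-- Log form of (c): under the same hypotheses the log-volumes of `A` and `g(A)` agree.
[cite: MochizukiAbsTopIII2015, Prop. 5.7 (i)(c) p. 138] -/
theorem log_haar_image_eq_of_coset_translate (A : CompactOpens V) (H : OpenAddSubgroup V)
    (hHA : ∀ a ∈ (A : Set V), a +ᵥ (H : Set V) ⊆ A) (g : V → V) (hinj : InjOn g A)
    (hg : ∀ a ∈ (A : Set V), g '' (a +ᵥ (H : Set V)) = g a +ᵥ (H : Set V)) :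
    Real.log (Λ.haar (g '' (A : Set V))).toReal = Real.log (Λ.haar A).toReal := by
  rw [Λ.haar_image_eq_of_coset_translate A H hHA g hinj hg]

end Cosets

section Nonarchimedean

variable {V : Type*} [AddCommGroup V] [TopologicalSpace V] [NonarchimedeanAddGroup V]
  (Λ : IntegralStructure V)

/-- **Small cosets inside a compact open set**: in a NONARCHIMEDEAN group, for `A` compact open there
is an open subgroup `H ≤ Λ` with `a + H ⊆ A` for every `a ∈ A` (each point has such a subgroup since
every neighbourhood of `0` contains an open subgroup; finitely many suffice by compactness; intersect
them). [cite: MochizukiAbsTopIII2015, Prop. 5.7 (i)(c) proof p. 139] -/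
theorem exists_openAddSubgroup_cosets_subset (A : CompactOpens V) :
    ∃ H : OpenAddSubgroup V, (H : AddSubgroup V) ≤ (Λ.toOpenAddSubgroup : AddSubgroup V) ∧
      ∀ a ∈ (A : Set V), a +ᵥ (H : Set V) ⊆ A := by
  classical
  -- for each point, an open subgroup whose coset stays in `A`
  have hpt : ∀ a ∈ (A : Set V), ∃ H : OpenAddSubgroup V, a +ᵥ (H : Set V) ⊆ A := by
    intro a ha
    have hnhds : (fun y => a + y) ⁻¹' (A : Set V) ∈ 𝓝 (0 : V) :=
      (continuous_const_add a).continuousAt.preimage_mem_nhds (by simpa using A.isOpen.mem_nhds ha)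
    obtain ⟨H, hH⟩ := NonarchimedeanAddGroup.is_nonarchimedean _ hnhds
    refine ⟨H, ?_⟩
    rintro _ ⟨h, hh, rfl⟩
    exact hH hh
  choose! H hH using hpt
  -- the open cover of the compact `A` by the cosets `a + H_a`
  obtain ⟨t, htA, hcover⟩ := A.isCompact.elim_nhds_subcover (fun a => a +ᵥ (H a : Set V))
    (fun a _ => ((H a).isOpen.vadd a).mem_nhds
      (Set.mem_vadd_set.mpr ⟨0, (H a).zero_mem, by simp⟩))
  refine ⟨(t.inf H) ⊓ Λ.toOpenAddSubgroup, inf_le_right, ?_⟩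
  intro a ha y hy
  obtain ⟨b, hb, hab⟩ : ∃ b ∈ t, a ∈ b +ᵥ (H b : Set V) := by
    simpa only [mem_iUnion, exists_prop] using hcover ha
  obtain ⟨h, hh, rfl⟩ := Set.mem_vadd_set.mp hy
  obtain ⟨c, hc, rfl⟩ := Set.mem_vadd_set.mp hab
  have hhb : h ∈ (H b : Set V) := by
    have : ((t.inf H) ⊓ Λ.toOpenAddSubgroup : OpenAddSubgroup V) ≤ H b :=
      inf_le_left.trans (Finset.inf_le hb)
    exact this hh
  refine hH b (htA b hb) (Set.mem_vadd_set.mpr ⟨c + h, (H b).add_mem hc hhb, ?_⟩)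
  simp only [vadd_eq_add, add_assoc]

variable [MeasurableSpace V] [BorelSpace V]

/-- **Uniqueness** ([AbsTopIII] Prop. 5.7 (i)(a) as printed): a function on `M(V)` satisfying (1)(2)(3)
IS the normalised Haar volume `A ↦ μ_Λ(A)`. [cite: MochizukiAbsTopIII2015, Prop. 5.7 (i)(a) p. 137] -/
theorem IsFinAddVolume.eq_haar {f : CompactOpens V → ℝ} (hf : IsFinAddVolume Λ f) (A : CompactOpens V) :
    f A = (Λ.haar (A : Set V)).toReal := by
  classical
  -- a small open subgroup `H ≤ Λ` whose cosets through points of `A` stay in `A`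
  obtain ⟨H, hHΛ, hHA⟩ := Λ.exists_openAddSubgroup_cosets_subset A
  obtain ⟨C, rep, hrep, hAeq⟩ := exists_finset_eq_biUnion_coset A H hHA
  -- the same subgroup decomposes `Λ`
  have hHΛ' : ∀ a ∈ (Λ.toCompactOpens : Set V), a +ᵥ (H : Set V) ⊆ Λ.toCompactOpens := by
    intro a ha y hy
    obtain ⟨h, hh, rfl⟩ := Set.mem_vadd_set.mp hy
    exact Λ.toOpenAddSubgroup.add_mem ha (hHΛ hh)
  obtain ⟨D, repΛ, hrepΛ, hΛeq⟩ := exists_finset_eq_biUnion_coset Λ.toCompactOpens H hHΛ'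
  -- values of `f` and of `μ_Λ` on `H`
  have hμ := isFinAddVolume_haar Λ
  have hfΛ := hf.map_eq_card_mul H hHΛ Λ.toCompactOpens D repΛ (fun c hc => (hrepΛ c hc).2) hΛeq
  have hμΛ := hμ.map_eq_card_mul H hHΛ Λ.toCompactOpens D repΛ (fun c hc => (hrepΛ c hc).2) hΛeq
  rw [hf.normalized] at hfΛ
  rw [hμ.normalized] at hμΛ
  have hfA := hf.map_eq_card_mul H hHΛ A C rep (fun c hc => (hrep c hc).2) hAeq
  have hμA := hμ.map_eq_card_mul H hHΛ A C rep (fun c hc => (hrep c hc).2) hAeq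
  simp only [coe_subgroupCompactOpens] at hμΛ hμA
  rw [hfA, hμA]
  congr 1
  -- `f(H) = μ_Λ(H)`: both equal `1/|D|`
  have hD : (D.card : ℝ) ≠ 0 := by
    intro h0
    rw [h0, zero_mul] at hfΛ
    exact one_ne_zero hfΛ
  apply mul_left_cancel₀ hD
  rw [← hfΛ, ← hμΛ]

/-- **[AbsTopIII] Prop. 5.7 (i)(a), existence and uniqueness**: there is exactly one `μ : M(V) → ℝ`
satisfying (1) additivity, (2) translation invariance, (3) `μ(Λ) = 1` — namely `A ↦ μ_Λ(A)` (which is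
moreover positive on nonempty sets, `haar_real_compactOpens_pos`).
[cite: MochizukiAbsTopIII2015, Prop. 5.7 (i)(a) p. 137] -/
theorem existsUnique_isFinAddVolume :
    ∃! f : CompactOpens V → ℝ, IsFinAddVolume Λ f :=
  ⟨fun A => (Λ.haar (A : Set V)).toReal, isFinAddVolume_haar Λ,
    fun _ hf => funext fun A => hf.eq_haar Λ A⟩

end Nonarchimedean

end IntegralStructure

end Literature.IUT.LogVolume
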